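import Literature.NumberTheory.EllipticCurves.LocalH1TateDualityLangTateProofs
import Literature.NumberTheory.EllipticCurves.MinimalModelReduction
import Literature.NumberTheory.EllipticCurves.GlobalMinimalModelProofs
import Literature.NumberTheory.EllipticCurves.NeronLocalHeightPotentialGoodReduction
import Literature.NumberTheory.EllipticCurves.HasseWeilGoodReductionFrobenius
import HarnessLib

/-!
# `#Ẽ_w(k_w) = #Ẽ_v(k_v)` along a finite extension at a good place with the same residue field
# (the base-change invariance of the reduction; Silverman VII.1.3(b) + VII.5.4(a))

HONEST FRAMING (cell `b2b-bsdres`, run/shared/lean/b2b/bsd-rank1-residual/, verbatim in every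
file): the goal of the cell is to DELETE the COMBINATION-SHAPED residual classes of the
Birch–Swinnerton-Dyer formula for ALL analytic-rank `≤ 1` elliptic curves over `ℚ` — "full BSD
formula for every rank `≤ 1` curve in class `C`" assembled STRICTLY from published theorems — so
that the rank-`≤ 1` remainder becomes exactly the CONSTRUCTION-SHAPED classes, which are TYPED
(missing-input `Prop`s), NOT attempted. This is not "finishing BSD". Sub-cell `additive-p2`
(X3♯(G-ord) / X4♯(G-ord)), generation 36, part 6: research route; no claim beyond the stated
classes; theorems only, no definition, no named fact, nothing booked, no label moved.

## What is proved

For number fields `K ⊆ L`, places `w ∣ v`, and an elliptic curve `V/K` with good reduction at `v`: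

* `natCard_point_reductionAt_baseChange_eq_of_natCard_residueField_eq` — if the residue fields of
  `O_v` and `O_w` have the same (finite) cardinality (`f(w|v) = 1`, e.g. both places of degree one
  over the same `p`), then **`#Ẽ_{L,w}(k_w) = #Ẽ_{K,v}(k_v)`** for the reductions of Mathlib's CHOSEN
  local minimal models (`WeierstrassCurve.reductionAt`). The `v`-minimal model pushed along
  `K_v → L_w` (tree `adicCompletionMap`; `|x|_w = |x|_v^{e}`) stays integral with unit discriminant,
  hence is `w`-minimal (Silverman VII.5.4(a) / Remark VII.1.1); by VII.1.3(b) (tree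
  `exists_variableChange_baseChange_eq_of_isMinimal`, `reduction_smul_eq_of_baseChange_eq`) the chosen
  `w`-minimal model has an isomorphic reduction; and the pushed model reduces to `Ẽ_v ⊗ k_w` along the
  residue-field embedding `k_v ↪ k_w`, a bijection when the cardinalities agree.

Use (parts 4–5, 7): every (G)-field place of a subfield `F ⊆ ℚ(ζ_p)` lies under the place of
`ℚ(ζ_p)`, all of degree one, so the anomalous bit of Delbourgo's `ReductionNonAnomalous W p` is read
at `ℚ(ζ_p)` alone.

References: J. H. Silverman, *AEC* VII.1 Prop. 1.3(b), Remark 1.1, VII.2, VII.5 Prop. 5.4(a);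
J.-P. Serre, *Local Fields* II §3.
-/

noncomputable section

open scoped Classical NumberField

open WeierstrassCurve IsDedekindDomain IsDedekindDomain.HeightOneSpectrum NumberField IsLocalRing

universe u

namespace Summit.BirchSwinnertonDyer.Rank1Residual.Additive

section BaseChange

variable {K : Type u} [Field K] [NumberField K] (L : Type u) [Field L] [NumberField L] [Algebra K L]
  (v : HeightOneSpectrum (𝓞 K)) (w : HeightOneSpectrum (𝓞 L)) [w.asIdeal.LiesOver v.asIdeal]
  (V : WeierstrassCurve K)

/-- Transport of the number of points of the reduction along an equality of minimal Weierstrass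
equations (the reduction depends on the equation only through a `Prop`-valued instance). [folklore] -/
theorem natCard_point_reduction_congr {F : Type*} [Field F] {R : Type*} [CommRing R] [IsDomain R]
    [IsDiscreteValuationRing R] [Algebra R F] [IsFractionRing R F] {Z₁ Z₂ : WeierstrassCurve F}
    (h : Z₁ = Z₂) [h₁ : IsMinimal R Z₁] [h₂ : IsMinimal R Z₂] :
    Nat.card (Z₁.reduction R).toAffine.Point = Nat.card (Z₂.reduction R).toAffine.Point := by
  subst h
  rfl

/-- **`#Ẽ_{L,w}(k_w) = #Ẽ_{K,v}(k_v)` when `f(w ∣ v) = 1`.** Let `K ⊆ L` be number fields, `w ∣ v`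
finite places whose completed residue fields have the same cardinality, and `V/K` an elliptic curve
with good reduction at `v`. Then the reductions of the chosen local minimal models of `V` at `v` and
of `V_L` at `w` have the same number of rational points. [cite: SilvermanAEC2009, Prop. VII.1.3(b), p. 186] -/
theorem natCard_point_reductionAt_baseChange_eq_of_natCard_residueField_eq [V.IsElliptic]
    (hgood : V.HasGoodReductionAt v)
    (hk : Nat.card (ResidueField (v.adicCompletionIntegers K)) =
      Nat.card (ResidueField (w.adicCompletionIntegers L))) :
    Nat.card ((V.baseChange L).reductionAt w).toAffine.Point =
      Nat.card (V.reductionAt v).toAffine.Point := by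
  -- notation
  let Ov := v.adicCompletionIntegers K
  let Ow := w.adicCompletionIntegers L
  let Kv := v.adicCompletion K
  let Lw := w.adicCompletion L
  let g : Kv →+* Lw := Literature.NumberTheory.EllipticCurves.adicCompletionMap (K := K) L v w
  -- the `v`-minimal model `X = C • V_{K_v}` and its integral model `M`
  have hX : (V.localMinimalModel v).HasGoodReduction Ov := hgood
  haveI := hX.toIsMinimal
  obtain ⟨C, hC⟩ : ∃ C : VariableChange Kv, C • V.baseChange Kv = V.localMinimalModel v := ⟨_, rfl⟩
  set M := (V.localMinimalModel v).integralModel Ov with hMdef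
  have hM : M.baseChange Kv = V.localMinimalModel v := baseChange_integralModel_eq Ov _
  -- `g` restricted to the valuation rings
  have hgle : ∀ x : Ov, g (x : Kv) ∈ Ow := fun x ↦
    (mem_adicCompletionIntegers _ _ _).mpr
      (Literature.NumberTheory.EllipticCurves.valued_adicCompletionMap_le_one L v w
        ((mem_adicCompletionIntegers _ _ _).mp x.2))
  let gO : Ov →+* Ow := (g.comp (algebraMap Ov Kv)).codRestrict Ow (fun x ↦ hgle x)
  have hgO : ∀ x : Ov, ((gO x : Ow) : Lw) = g (x : Kv) := fun x ↦ rfl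
  have hgOcomp : (algebraMap Ow Lw).comp gO = g.comp (algebraMap Ov Kv) := RingHom.ext fun x ↦ rfl
  haveI : IsLocalHom gO := by
    refine ⟨fun a ha ↦ ?_⟩
    rw [adicCompletionIntegers.isUnit_iff_valued_eq_one] at ha ⊢
    have h1 : Valued.v ((gO a : Ow) : Lw) = Valued.v (a : Kv) ^ w.asIdeal.ramificationIdx (𝓞 K) := by
      rw [hgO]; exact Literature.NumberTheory.EllipticCurves.valued_adicCompletionMap L v w _
    have hle : Valued.v (a : Kv) ≤ 1 := (mem_adicCompletionIntegers _ _ _).mp a.2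
    rcases hle.eq_or_lt with h | h
    · exact h
    · exfalso
      have hlt := Literature.NumberTheory.EllipticCurves.valued_adicCompletionMap_lt_one L v w h
      rw [← hgO, ha] at hlt
      exact lt_irrefl _ hlt
  -- the pushed model `X' = X.map g` is integral with unit discriminant, hence minimal at `w`
  set X' := (V.localMinimalModel v).map g with hX'def
  have hX'int : (M.map gO).baseChange Lw = X' := by
    rw [hX'def, ← hM, baseChange, baseChange, map_map, map_map, hgOcomp]
  haveI hI' : IsIntegral Ow X' := ⟨M.map gO, hX'int.symm⟩
  have hΔv : Valued.v (V.localMinimalModel v).Δ = 1 :=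
    (Valuation.isEquiv_iff_val_eq_one.mp
      (Literature.NumberTheory.EllipticCurves.isEquiv_valuation_maximalIdeal_valued v)).mp
      hX.goodReduction
  have hΔ' : (IsDiscreteValuationRing.maximalIdeal Ow).valuation Lw X'.Δ = 1 := by
    refine (Valuation.isEquiv_iff_val_eq_one.mp
      (Literature.NumberTheory.EllipticCurves.isEquiv_valuation_maximalIdeal_valued w)).mpr ?_
    rw [hX'def, map_Δ]
    exact Literature.NumberTheory.EllipticCurves.valued_adicCompletionMap_eq_one L v w hΔv
  haveI hmin' : IsMinimal Ow X' := isMinimal_of_valuation_Δ_eq_one X' hΔ'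
  have hΔX' : X'.Δ ≠ 0 := by
    intro h0
    rw [h0, map_zero] at hΔ'
    exact zero_ne_one hΔ'
  -- the chosen `w`-minimal model `Y = C' • Z`, `Z = (V_L)_{L_w} = V_{K_v}.map g`, so `Y = D • X'`
  obtain ⟨C', hC'⟩ : ∃ C' : VariableChange Lw,
      C' • (V.baseChange L).baseChange Lw = (V.baseChange L).localMinimalModel w := ⟨_, rfl⟩
  have hZ : (V.baseChange L).baseChange Lw = (V.baseChange Kv).map g := by
    rw [baseChange, baseChange, baseChange, map_map, map_map,
      Literature.NumberTheory.EllipticCurves.adicCompletionMap_comp_algebraMap,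
      ← IsScalarTower.algebraMap_eq]
  have hY : (C' * (C.map g)⁻¹) • X' = (V.baseChange L).localMinimalModel w := by
    rw [← hC', hZ, hX'def, ← hC, ← map_variableChange, smul_smul, mul_assoc, inv_mul_cancel, mul_one]
  haveI hminY : IsMinimal Ow ((C' * (C.map g)⁻¹) • X') := hY ▸ inferInstance
  obtain ⟨D, hD⟩ := exists_variableChange_baseChange_eq_of_isMinimal (R := Ow) X' (C' * (C.map g)⁻¹) hΔX'
  have hred' : ((C' * (C.map g)⁻¹) • X').reduction Ow = D.map (residue Ow) • X'.reduction Ow :=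
    reduction_smul_eq_of_baseChange_eq X' _ D hD
  -- `X'` reduces to `Ẽ_v` pushed along `k_v → k_w`
  have hXred : X'.reduction Ow = (V.reductionAt v).map (ResidueField.map gO) := by
    rw [reduction, integralModel_eq_of_baseChange_eq X' (M.map gO) hX'int, map_map,
      ← ResidueField.map_comp_residue, ← map_map]
    rfl
  -- `k_v → k_w` is a bijection
  have hbij : Function.Bijective (ResidueField.map gO) := by
    haveI : Finite (ResidueField Ow) := by
      have hne : Nat.card (ResidueField Ow) ≠ 0 := by
        rw [← hk, HeightOneSpectrum.natCard_residueField_adicCompletionIntegers K v]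
        exact Nat.card_pos.ne'
      exact Nat.finite_of_card_ne_zero hne
    exact (Nat.bijective_iff_injective_and_card _).mpr ⟨(ResidueField.map gO).injective, hk⟩
  -- assemble
  calc Nat.card ((V.baseChange L).reductionAt w).toAffine.Point
      = Nat.card (((C' * (C.map g)⁻¹) • X').reduction Ow).toAffine.Point :=
        natCard_point_reduction_congr hY.symm
    _ = Nat.card (X'.reduction Ow).toAffine.Point := by rw [hred', natCard_point_smul]
    _ = Nat.card (V.reductionAt v).toAffine.Point := by
        rw [hXred, show ResidueField.map gO = ((RingEquiv.ofBijective _ hbij : _ ≃+* _) : _ →+* _)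
          from rfl, natCard_point_map_ringEquiv]

end BaseChange

end Summit.BirchSwinnertonDyer.Rank1Residual.Additive

end
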